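import Summits.BirchSwinnertonDyer.Rank1Residual.P2.CongruentNumberPairsAtTwo
import Literature.NumberTheory.EllipticCurves.Wang2016.SelmerRankTwoIffFourRankOne
import HarnessLib

/-!
# Sub-lane «bsd-p2»: KERNEL-CERTIFIED PAIRS WITH NON-TRIVIAL `Ш[2^∞]` — door D-CM-3 (Wang 2016 Thm 3
# + Lemma 4 + Monsky) at `k = 1`: for EVERY prime `q ≡ 1 (mod 8)` with `q = u² + 8v²`, `v` odd,
# `BSD(E_q, 2)` with `rank E_q(ℚ) = 0` and `#Ш(E_q)[2^∞] = 4`; instances `q ∈ {17, 73, 89, 97} = U_CN ∩ D-CM-3`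

HONEST FRAMING (sub-lane «bsd-p2», run/shared/lean/b2b/bsd-rank1-residual/p2/, verbatim in every
file): the target of record is the FULL Birch–Swinnerton-Dyer formula for EVERY analytic-rank `≤ 1`
`E/ℚ` at ALL primes INCLUDING `2`; the odd-prime class ledger is referee A's; the `2`-part is OPEN
(cells O1 = X5 ∖ CM and O12 = the CM corner) and under census by «bsd-p2». Census / instrument
output at `2` = EVIDENCE / conjecture items with held-out validation, NEVER a Literature fact;
certificates close PAIRS (one isogeny class, `p = 2`), never classes. This file asserts NO
arithmetic fact and proves no door of its own: the door is p2-lit-1's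
`Wang2016.forall_bsdp_of_thm3_of_lem4_of_monsky` / `bsdTriple_of_thm3_of_lem4_of_monsky` (p320035;
SIX named journal facts as binders: Wang 2016 Thm 3 `h3`, Wang Lemma 4 `hL`, Monsky 1994 `hM`,
Burungale–Tian 2026 Thm 1.1 `hBT`, Deuring–Hecke `hH`, Burungale–Flach 2024 Cor 2 `hBF`; decidable
inputs: primes `≡ 1 (mod 8)`, Monsky rank `s(n) = 2`, `δ_n` odd). WHAT THIS FILE ADDS (typer, one
writer of `P2/`): §1 the `k = 1` case made GENERIC — for a prime `q ≡ 1 (mod 8)` Monsky's matrix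
VANISHES (`(2/q) = (−2/q) = 1`, quadratic reciprocity supplements, Mathlib's `χ₈`, `χ₈'`), so
`s(q) = 2` for EVERY such prime (Heath-Brown 1994 §1: "`s(p) = 2` for `p ≡ 1 (mod 8)`" — here a kernel
theorem, not a fact), and `δ_q` odd ⟺ `q = u² + 8v²` with `v` odd (`Wang2016.IsDeltaOne q`); hence the
CLASS door `bsdp_two_congruentNumberCurve_of_prime_one_mod_eight`: for every prime `q ≡ 1 (mod 8)`
with `IsDeltaOne q`, `BSD(E_q, 2)`, `rank E_q(ℚ) = 0`, `#Ш(E_q/ℚ)[2^∞] = 4` — a NAMED, DECIDABLE,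
INFINITE class of pairs with NON-TRIVIAL `Ш` at `2`, closed in the kernel modulo the six journal
facts; §2 the in-range instances (`U_CN`, conductor `32q² < 5·10⁵`): `q ∈ {17, 73, 89, 97}`
(`17 = 3² + 8·1²` — lit-1's `isDeltaOne_seventeen` —, `73 = 1² + 8·3²`, `89 = 9² + 8·1²`, `97 = 5² + 8·3²`;
the other in-range primes
`≡ 1 (mod 8)`, `41 = 3² + 8·2²` and `113 = 9² + 8·2²`, have `δ = 0` and are NOT in the door's family —
said plainly; `17` is also lit-1's showcase `bsdTriple_congruentNumberCurve_seventeen_journal`).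
Cells: CM, `2` ramified, `r_an = 0` ⇒ `coveredC8` — pairs, not classes; what is new is `Ш[2^∞] ≠ 0`
decided in the kernel. Nothing booked; no mark moved. Unit `b2b-bsdres-p2-typer` GEN 3 (p2-lead
L1-12 / T-34: "the D-CM-3 instance batch is yours"); NEW file.

References: Wang Zhangjie, Sci. China Math. 59 (2016) Thm. 3, Lemma 4 [Wang2016CongruentSha];
Heath-Brown, Invent. Math. 118 (1994) §1 and Appendix (Monsky) [HeathBrown1994SelmerCongruentII];
Burungale–Tian 2026 Thm 1.1 [BurungaleTian2026]; Burungale–Flach 2024 Cor 2 [BurungaleFlach2024];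
Miller 2011 Def 1.1 [Miller2011LMS]; HOME/p2/LEAD-OKS.md L1-12, T-34.
-/

noncomputable section

open scoped Classical

open Matrix WeierstrassCurve Literature.NumberTheory.EllipticCurves
  Literature.NumberTheory.EllipticCurves.Rank1Residual
  Literature.NumberTheory.EllipticCurves.Rank1Residual.Typed
  Literature.NumberTheory.EllipticCurves.HeathBrown1994
  Literature.NumberTheory.EllipticCurves.Wang2016

set_option autoImplicit false

namespace Summit.BirchSwinnertonDyer.Rank1Residual.P2

/-! ## §1 `k = 1`: a prime `q ≡ 1 (mod 8)` has Monsky matrix `0`, so `s(q) = 2` — generically -/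

/-- `(2/q) = 1` for a prime (indeed any odd) `q ≡ 1 (mod 8)` (second supplement; Mathlib's
`jacobiSym.at_two`, `χ₈`). [cite: IrelandRosen1990, Ch. 5 §1 Prop. 5.1.3] -/
theorem jacobiSym_two_of_mod_eight_eq_one {q : ℕ} (h8 : q % 8 = 1) : jacobiSym 2 q = 1 := by
  have hodd : Odd q := Nat.odd_iff.mpr (by omega)
  rw [jacobiSym.at_two hodd, ZMod.χ₈_nat_eq_if_mod_eight]
  have h2 : q % 2 ≠ 0 := by omega
  simp [h2, h8]

/-- `(−2/q) = 1` for `q ≡ 1 (mod 8)` (`χ₈'`). [cite: IrelandRosen1990, Ch. 5 §1 Prop. 5.1.3] -/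
theorem jacobiSym_neg_two_of_mod_eight_eq_one {q : ℕ} (h8 : q % 8 = 1) : jacobiSym (-2) q = 1 := by
  have hodd : Odd q := Nat.odd_iff.mpr (by omega)
  rw [jacobiSym.at_neg_two hodd, ZMod.χ₈'_nat_eq_if_mod_eight]
  have h2 : q % 2 ≠ 0 := by omega
  simp [h2, h8]

/-- **Monsky's matrix of a single prime `q ≡ 1 (mod 8)` is ZERO**: `A = (0)` (one prime, empty row
sum), `D₂ = D₋₂ = (0)` since `2` and `−2` are squares mod `q`. [cite: HeathBrown1994SelmerCongruentII, Appendix (Monsky), typescript p. 39 L27–L33] -/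
theorem monskyMatrixOdd_singleton_eq_zero {q : ℕ} (h8 : q % 8 = 1) : monskyMatrixOdd ![q] = 0 := by
  have h2 : addLegendreSym 2 q = 0 := addLegendreSym_of_eq_one (jacobiSym_two_of_mod_eight_eq_one h8)
  have hm2 : addLegendreSym (-2) q = 0 :=
    addLegendreSym_of_eq_one (jacobiSym_neg_two_of_mod_eight_eq_one h8)
  ext i j
  rcases i with i | i <;> rcases j with j | j <;>
    · obtain rfl : i = 0 := Subsingleton.elim _ _
      obtain rfl : j = 0 := Subsingleton.elim _ _
      simp [monskyMatrixOdd, legendreMatrix, legendreDiagonal, Matrix.fromBlocks, h2, hm2]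

/-- **`s(q) = 2` for every prime `q ≡ 1 (mod 8)`** in Monsky's matrix form (Heath-Brown 1994 §1:
"when `D` is prime … `s(D)` is `2` for `D ≡ 1 (mod 8)`" — here a kernel theorem: rank of the zero
matrix). [cite: HeathBrown1994SelmerCongruentII, §1 typescript p. 6 L26–L28] -/
theorem monskySelmerRankOdd_singleton {q : ℕ} (h8 : q % 8 = 1) : monskySelmerRankOdd ![q] = 2 := by
  rw [monskySelmerRankOdd, monskyMatrixOdd_singleton_eq_zero h8, Matrix.rank_zero]

/-- `δ_q = 1` for a prime `q` with `q = u² + 8v²`, `v` odd (`deltaCount q` counts the prime factors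
with `δ = 1`; a prime has one). [cite: Wang2016CongruentSha, Thm. 3 (i) (arXiv:1511.03810 p0011 L127)] -/
theorem deltaCount_eq_one_of_prime {q : ℕ} (hq : q.Prime) (hδ : IsDeltaOne q) :
    deltaCount q = 1 := by
  rw [deltaCount, Nat.Prime.primeFactors hq, Finset.filter_singleton, if_pos hδ,
    Finset.card_singleton]

/-- **THE CLASS DOOR D-CM-3 AT `k = 1`.** For EVERY prime `q ≡ 1 (mod 8)` of the form
`q = u² + 8v²` with `v` odd (`IsDeltaOne q`, decidable by bounded search): `BSD(E_q, 2)` for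
`E_q : y² = x³ − q²x`, together with `rank E_q(ℚ) = 0` and `#Ш(E_q/ℚ)[2^∞] = 4`. Inputs of
p2-lit-1's door discharged here: `s(q) = 2` (`monskySelmerRankOdd_singleton`) and `δ_q = 1`; the six
named journal facts stay binders (Wang 2016 Thm 3 `h3` + Lemma 4 `hL`, Monsky 1994 `hM`,
Burungale–Tian 2026 `hBT`, Deuring–Hecke `hH`, Burungale–Flach 2024 `hBF`). An infinite, named,
decidable class of PAIRS with NON-TRIVIAL `Ш` at `2` closed in the kernel; cells `coveredC8` (CM,
rank `0`) — the cell statement itself was already covered (Burungale–Flach given `L ≠ 0`); new is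
that membership and `#Ш[2^∞] = 4` are decided without an `L`-value.
[cite: Wang2016CongruentSha, Thm. 3 and Lemma 4] [cite: HeathBrown1994SelmerCongruentII, §1 typescript p. 6 L26–L28]
[cite: BurungaleTian2026, Thm. 1.1] [cite: BurungaleFlach2024, Thm 1.1 and Cor. 2] [cite: Miller2011LMS, Def. 1.1] -/
theorem bsdp_two_congruentNumberCurve_of_prime_one_mod_eight
    (h3 : thm3_rank_zero_and_sha_two_by_two) (hL : lem4_card_selmerGroup_two_eq_sixteen_iff_h4)
    (hM : monsky_card_selmerGroup_two_odd)
    (hBT : burungaleTian_analyticRank_eq_zero_of_selmerCorank_eq_zero_of_hasCM)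
    (hH : hasEntireLFunction_of_j_mem_maximalCMJInvariants)
    (hBF : bsdTriple_of_hasCM_of_L_one_ne_zero)
    {q : ℕ} (hq : q.Prime) (h8 : q % 8 = 1) (hδ : IsDeltaOne q) :
    haveI := isElliptic_congruentNumberCurve hq.ne_zero
    BSDp (congruentNumberCurve q) 2 ∧ (congruentNumberCurve q).mordellWeilRank = 0 ∧
      Nat.card (AddCommGroup.primaryComponent (congruentNumberCurve q).sha 2) = 4 := by
  have hp : ∀ i, ((![q] : Fin 1 → ℕ) i).Prime := fun i => by fin_cases i; exact hq
  have h8' : ∀ i, (![q] : Fin 1 → ℕ) i % 8 = 1 := fun i => by fin_cases i; exact h8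
  have hinj : Function.Injective (![q] : Fin 1 → ℕ) := Function.injective_of_subsingleton _
  have hprod : ∏ i, (![q] : Fin 1 → ℕ) i = q := by simp
  have hodd : Odd (deltaCount q) := by rw [deltaCount_eq_one_of_prime hq hδ]; exact odd_one
  have hB := bsdTriple_of_thm3_of_lem4_of_monsky ![q] h3 hL hM hBT hH hBF hp h8' hinj
    (monskySelmerRankOdd_singleton h8) hprod hodd
  have hP := forall_bsdp_of_thm3_of_lem4_of_monsky ![q] h3 hL hM hBT hH hBF hp h8' hinj
    (monskySelmerRankOdd_singleton h8) hprod hodd 2 Nat.prime_two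
  exact ⟨hP, hB.2.1, hB.2.2⟩

/-! ## §2 The in-range instances `q ∈ {17, 73, 89, 97}` (U_CN ∩ D-CM-3; `41`, `113` have `δ = 0`) -/

/-- `73 = 1² + 8·3²`. [cite: Wang2016CongruentSha, Thm. 3 (1) (arXiv:1511.03810 p0011 L110)] -/
theorem isDeltaOne_73 : IsDeltaOne 73 := ⟨1, 3, by norm_num, by decide⟩

/-- `89 = 9² + 8·1²`. [cite: Wang2016CongruentSha, Thm. 3 (1) (arXiv:1511.03810 p0011 L110)] -/
theorem isDeltaOne_89 : IsDeltaOne 89 := ⟨9, 1, by norm_num, odd_one⟩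

/-- `97 = 5² + 8·3²`. [cite: Wang2016CongruentSha, Thm. 3 (1) (arXiv:1511.03810 p0011 L110)] -/
theorem isDeltaOne_97 : IsDeltaOne 97 := ⟨5, 3, by norm_num, by decide⟩

/-- **`BSD(E_17, 2)`, rank `0`, `#Ш(E_17)[2^∞] = 4`** (`y² = x³ − 289x`, Cremona class `9248e1`,
`N = 9248`; `#Ш_an = 4`), through the D-CM-3 door. [cite: Wang2016CongruentSha, Thm. 3] [cite: BurungaleFlach2024, Cor. 2] -/
theorem bsdp_two_congruentNumberCurve_17 (h3 : thm3_rank_zero_and_sha_two_by_two)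
    (hL : lem4_card_selmerGroup_two_eq_sixteen_iff_h4) (hM : monsky_card_selmerGroup_two_odd)
    (hBT : burungaleTian_analyticRank_eq_zero_of_selmerCorank_eq_zero_of_hasCM)
    (hH : hasEntireLFunction_of_j_mem_maximalCMJInvariants)
    (hBF : bsdTriple_of_hasCM_of_L_one_ne_zero) :
    haveI := isElliptic_congruentNumberCurve (n := 17) (by norm_num)
    BSDp (congruentNumberCurve 17) 2 ∧ (congruentNumberCurve 17).mordellWeilRank = 0 ∧
      Nat.card (AddCommGroup.primaryComponent (congruentNumberCurve 17).sha 2) = 4 :=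
  bsdp_two_congruentNumberCurve_of_prime_one_mod_eight h3 hL hM hBT hH hBF (by norm_num) rfl
    isDeltaOne_seventeen

/-- **`BSD(E_73, 2)`, rank `0`, `#Ш(E_73)[2^∞] = 4`** (`y² = x³ − 73²x`, class `170528a1`,
`N = 170528`). [cite: Wang2016CongruentSha, Thm. 3] [cite: BurungaleFlach2024, Cor. 2] -/
theorem bsdp_two_congruentNumberCurve_73 (h3 : thm3_rank_zero_and_sha_two_by_two)
    (hL : lem4_card_selmerGroup_two_eq_sixteen_iff_h4) (hM : monsky_card_selmerGroup_two_odd)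
    (hBT : burungaleTian_analyticRank_eq_zero_of_selmerCorank_eq_zero_of_hasCM)
    (hH : hasEntireLFunction_of_j_mem_maximalCMJInvariants)
    (hBF : bsdTriple_of_hasCM_of_L_one_ne_zero) :
    haveI := isElliptic_congruentNumberCurve (n := 73) (by norm_num)
    BSDp (congruentNumberCurve 73) 2 ∧ (congruentNumberCurve 73).mordellWeilRank = 0 ∧
      Nat.card (AddCommGroup.primaryComponent (congruentNumberCurve 73).sha 2) = 4 :=
  bsdp_two_congruentNumberCurve_of_prime_one_mod_eight h3 hL hM hBT hH hBF (by norm_num) rfl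
    isDeltaOne_73

/-- **`BSD(E_89, 2)`, rank `0`, `#Ш(E_89)[2^∞] = 4`** (`y² = x³ − 89²x`, class `253472b1`,
`N = 253472`). [cite: Wang2016CongruentSha, Thm. 3] [cite: BurungaleFlach2024, Cor. 2] -/
theorem bsdp_two_congruentNumberCurve_89 (h3 : thm3_rank_zero_and_sha_two_by_two)
    (hL : lem4_card_selmerGroup_two_eq_sixteen_iff_h4) (hM : monsky_card_selmerGroup_two_odd)
    (hBT : burungaleTian_analyticRank_eq_zero_of_selmerCorank_eq_zero_of_hasCM)
    (hH : hasEntireLFunction_of_j_mem_maximalCMJInvariants)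
    (hBF : bsdTriple_of_hasCM_of_L_one_ne_zero) :
    haveI := isElliptic_congruentNumberCurve (n := 89) (by norm_num)
    BSDp (congruentNumberCurve 89) 2 ∧ (congruentNumberCurve 89).mordellWeilRank = 0 ∧
      Nat.card (AddCommGroup.primaryComponent (congruentNumberCurve 89).sha 2) = 4 :=
  bsdp_two_congruentNumberCurve_of_prime_one_mod_eight h3 hL hM hBT hH hBF (by norm_num) rfl
    isDeltaOne_89

/-- **`BSD(E_97, 2)`, rank `0`, `#Ш(E_97)[2^∞] = 4`** (`y² = x³ − 97²x`, class `301088b1`,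
`N = 301088`). [cite: Wang2016CongruentSha, Thm. 3] [cite: BurungaleFlach2024, Cor. 2] -/
theorem bsdp_two_congruentNumberCurve_97 (h3 : thm3_rank_zero_and_sha_two_by_two)
    (hL : lem4_card_selmerGroup_two_eq_sixteen_iff_h4) (hM : monsky_card_selmerGroup_two_odd)
    (hBT : burungaleTian_analyticRank_eq_zero_of_selmerCorank_eq_zero_of_hasCM)
    (hH : hasEntireLFunction_of_j_mem_maximalCMJInvariants)
    (hBF : bsdTriple_of_hasCM_of_L_one_ne_zero) :
    haveI := isElliptic_congruentNumberCurve (n := 97) (by norm_num)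
    BSDp (congruentNumberCurve 97) 2 ∧ (congruentNumberCurve 97).mordellWeilRank = 0 ∧
      Nat.card (AddCommGroup.primaryComponent (congruentNumberCurve 97).sha 2) = 4 :=
  bsdp_two_congruentNumberCurve_of_prime_one_mod_eight h3 hL hM hBT hH hBF (by norm_num) rfl
    isDeltaOne_97

end Summit.BirchSwinnertonDyer.Rank1Residual.P2

end
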